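import Mathlib

/-!
# Stub `stub_multilinearVanish` (crux `FreeSubtorus.OrbitDimensionBound`, line `Sketch`)

Pure multilinear algebra used in step (a) ("product reduction") of the product-rank ladder:
if a multilinear form `f` on `ι` copies of `V` satisfies `f (x + t • y) = 0` for every scalar
`t : ℂ`, and `y` is supported inside a finset `S` (`y i = 0` for `i ∉ S`), then the "top
coefficient" `f (S.piecewise y x)` (arguments `y i` for `i ∈ S`, `x i` for `i ∉ S`) vanishes.

Proof: expand `f (x + t • y) = ∑_T f (T.piecewise (t • y) x)` (`MultilinearMap.map_add_univ`),
pull out the scalars (`MultilinearMap.map_piecewise_smul`) to get `t ^ #T * f (T.piecewise y x)`,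
kill the terms with `T ⊄ S` (`MultilinearMap.map_coord_zero`, some argument is `y i = 0`), and
read off the coefficient of `X ^ #S` of the resulting polynomial, which vanishes on all of `ℂ`
and hence is zero (`Polynomial.funext`); the only `T ⊆ S` with `#T = #S` is `S` itself
(`Finset.eq_of_subset_of_card_le`). [folklore]
-/

set_option linter.dupNamespace false

namespace Summit.ValiantsHypothesis.ValiantsHypothesis.Theorems.FreeSubtorusOrbitDimensionBound

open Polynomial

/-- Scalar pull-out on one piece: replacing `y` by `t • y` on the finset `s` multiplies the value
of the multilinear form by `t ^ #s` (`MultilinearMap.map_piecewise_smul`). [folklore] -/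
theorem multilinearVanish_piecewise_smul {ι : Type} [DecidableEq ι] {V : Type} [AddCommGroup V]
    [Module ℂ V] (f : MultilinearMap ℂ (fun _ : ι => V) ℂ) (x y : ι → V) (s : Finset ι) (t : ℂ) :
    f (s.piecewise (t • y) x) = t ^ s.card * f (s.piecewise y x) := by
  have h := f.map_piecewise_smul (fun _ => t) (s.piecewise y x) s
  rw [Finset.prod_const, smul_eq_mul] at h
  rw [← h]
  congr 1
  ext i
  by_cases hi : i ∈ s <;> simp [hi]

/-- Multilinear expansion along the line `x + t • y` when `y` is supported in `S`:
`f (x + t • y) = ∑_{s ⊆ S} t ^ #s * f (s.piecewise y x)`; the pieces `s ⊄ S` carry an argument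
`y i = 0` and vanish (`MultilinearMap.map_coord_zero`). [folklore] -/
theorem multilinearVanish_expand {ι : Type} [Fintype ι] [DecidableEq ι] {V : Type}
    [AddCommGroup V] [Module ℂ V] (f : MultilinearMap ℂ (fun _ : ι => V) ℂ) (x y : ι → V)
    (S : Finset ι) (hy : ∀ i, i ∉ S → y i = 0) (t : ℂ) :
    f (x + t • y) = ∑ s ∈ S.powerset, t ^ s.card * f (s.piecewise y x) := by
  rw [add_comm, f.map_add_univ]
  symm
  refine (Finset.sum_congr rfl fun s _ =>
    (multilinearVanish_piecewise_smul f x y s t).symm).trans ?_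
  refine Finset.sum_subset (Finset.subset_univ _) fun s _ hs => ?_
  rw [Finset.mem_powerset, Finset.not_subset] at hs
  obtain ⟨i, his, hiS⟩ := hs
  exact f.map_coord_zero i (by simp [his, hy i hiS])

/-- **Stub `stub_multilinearVanish`.**  If a multilinear form `f` satisfies `f (x + t • y) = 0`
for every scalar `t`, and `y` is supported in `S`, then the "top coefficient"
`f (S.piecewise y x)` vanishes: the polynomial `∑_{s ⊆ S} f (s.piecewise y x) X ^ #s` vanishes on
`ℂ`, hence is zero (`Polynomial.funext`), and its coefficient of `X ^ #S` is `f (S.piecewise y x)`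
(`Finset.eq_of_subset_of_card_le`). [folklore] -/
theorem stub_multilinearVanish :
    ∀ {ι : Type} [Fintype ι] [DecidableEq ι] {V : Type} [AddCommGroup V] [Module ℂ V]
      (f : MultilinearMap ℂ (fun _ : ι => V) ℂ) (x y : ι → V) (S : Finset ι),
      (∀ i, i ∉ S → y i = 0) → (∀ t : ℂ, f (x + t • y) = 0) → f (S.piecewise y x) = 0 := by
  intro ι _ _ V _ _ f x y S hy hf
  have hP : (∑ s ∈ S.powerset, C (f (s.piecewise y x)) * X ^ s.card : ℂ[X]) = 0 := by
    refine Polynomial.funext fun t => ?_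
    rw [eval_zero, eval_finsetSum, ← hf t, multilinearVanish_expand f x y S hy t]
    exact Finset.sum_congr rfl fun s _ => by rw [eval_mul, eval_C, eval_pow, eval_X, mul_comm]
  have hc := congrArg (fun P : ℂ[X] => P.coeff S.card) hP
  simp only [finsetSum_coeff, coeff_C_mul_X_pow, coeff_zero] at hc
  rw [Finset.sum_eq_single_of_mem S (Finset.mem_powerset_self S), if_pos rfl] at hc
  · exact hc
  · intro s hs hsS
    rw [if_neg]
    exact fun h => hsS (Finset.eq_of_subset_of_card_le (Finset.mem_powerset.1 hs) h.le)

end Summit.ValiantsHypothesis.ValiantsHypothesis.Theorems.FreeSubtorusOrbitDimensionBound
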